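import Mathlib.RingTheory.Polynomial.Pochhammer
import Mathlib.FieldTheory.IntermediateField.Adjoin.Basic
import Literature.Barriers.Schanuel.EFunctionValuesAtAlgebraicPointsArith
import HarnessLib

/-!
# The coefficients of an `E`-function lie in a number field (Rivoal §5.1, p. 228) — PROVED

`Literature/Barriers/Schanuel/EFunctionValuesAtAlgebraicPointsCoeffField.lean` — sibling file of
`EFunctionValuesAtAlgebraicPoints.lean` in the programme to discharge `siegelShidlovskii_algIndep` (`Literature/Barriers/Schanuel/EFunctionValuesAtAlgebraicPoints.lean`,
Rivoal Thm. 5.10). The reduction of Thm. 5.10 to the rank theorem 5.20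
(`shidlovskii_rankBound`, `SiegelShidlovskiiRank.lean`) applies Thm. 5.20 over ONE number field
`K` containing `α`, the coefficients of the hypothetical algebraic relation, and ALL Taylor
coefficients of the `E`-functions involved; that the latter lie in a number field is the remark
printed right after Définition 5.2:

* [Rivoal2024] §5.1, p. 228: "La condition (i) équivaut à dire que la suite `(aₙ/n!)ₙ` (et donc
  aussi `(aₙ)ₙ`) satisfait à une récurrence linéaire d'ordre fini à coefficients dans `ℚ̄[n]`. Il en
  découle que les `aₙ` vivent dans un certain corps de nombres galoisien `K`".

Main result `IsStrictEFunction.exists_finset_adjoin`: for a strict `E`-function with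
coefficient sequence `a` there is a finite set `S` of algebraic numbers with `aₙ ∈ ℚ(S)` for all
`n` (so `ℚ(S)` is a number field; we do not need it Galois). The proof is the printed one, made
explicit: writing the differential equation (i) `∑ⱼ Pⱼ(z) F⁽ʲ⁾(z) = 0` coefficientwise
(`eSeries` calculus of `EFunctionValuesAtAlgebraicPointsSeries.lean`/`…Arith.lean`: `F⁽ʲ⁾ = eSeries (n ↦ aₙ₊ⱼ)`,
`zᵏ · eSeries b = eSeries (n ↦ n(n-1)⋯(n-k+1) bₙ₋ₖ)`, and `eSeries c ≡ 0 ⇒ c = 0`) gives the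
recurrence `∑_{j,k} pⱼₖ · n(n-1)⋯(n-k+1) · a_{n-k+j} = 0`; grouping the terms of maximal shift
`s = j - k` yields a leading coefficient `Λ(n) = ∑ pⱼₖ n(n-1)⋯(n-k+1)`, a NON-ZERO polynomial in
`n` (the descending factorials have distinct degrees `k`), hence non-vanishing for `n ≥ N₀`, and
the recurrence then expresses every `a_t`, `t ≥ N₀ + s`, rationally in terms of earlier
coefficients and the `pⱼₖ`.

## References

* [Rivoal2024] T. Rivoal, *Les E-fonctions et G-fonctions de Siegel*, Journées X-UPS 2019
  (2024), doi:10.5802/xups.2019-03: Définition 5.2 (p. 227) and the remark p. 228.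
-/

noncomputable section

open Complex Polynomial Finset
open scoped Nat

namespace Literature.Barriers.Schanuel

-- `ℚ`-algebra diamond on subfields of `ℂ`: see `EFunctionValuesAtAlgebraicPointsArith.lean`.
attribute [-instance] DivisionRing.toRatAlgebra

variable {a : ℕ → ℂ}

/-! ### 1. More `E`-series calculus: `zᵏ F(z)`, vanishing -/

/-- Coefficient sequence of `zᵏ F(z)`: `n(n-1)⋯(n-k+1) · aₙ₋ₖ`. [folklore] -/
def mulXpow (k : ℕ) (a : ℕ → ℂ) (n : ℕ) : ℂ :=
  (n.descFactorial k : ℂ) * a (n - k)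

/-- `mulXpow 0 a = a`. [folklore] -/
@[simp] theorem mulXpow_zero (a : ℕ → ℂ) : mulXpow 0 a = a := by
  funext n
  simp [mulXpow]

/-- `mulXpow (k+1) a = (n ↦ n · (mulXpow k a)ₙ₋₁)`. [folklore] -/
theorem mulXpow_succ (k : ℕ) (a : ℕ → ℂ) :
    mulXpow (k + 1) a = fun n : ℕ => (n : ℂ) * mulXpow k a (n - 1) := by
  funext n
  cases n with
  | zero => simp [mulXpow]
  | succ n =>
    simp only [mulXpow, Nat.succ_descFactorial_succ, Nat.cast_mul, Nat.add_sub_cancel]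
    rw [show n + 1 - (k + 1) = n - k by omega]
    ring

/-- `mulXpow k a` is geometrically bounded. [folklore] -/
theorem expBound_mulXpow (ha : ExpBound a) (k : ℕ) : ExpBound (mulXpow k a) := by
  induction k with
  | zero => simpa using ha
  | succ k ih => rw [mulXpow_succ]; exact ih.mulX

/-- `zᵏ · eSeries a z = eSeries (mulXpow k a) z`. [folklore] -/
theorem ExpBound.pow_mul_eSeries (ha : ExpBound a) (k : ℕ) (z : ℂ) :
    z ^ k * eSeries a z = eSeries (mulXpow k a) z := by
  induction k with
  | zero => simp
  | succ k ih =>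
    rw [pow_succ', mul_assoc, ih, (expBound_mulXpow ha k).mul_eSeries, mulXpow_succ]

/-- **Vanishing**: an identically vanishing `E`-series with geometrically bounded coefficients
has all coefficients `0` (`cₙ = (eSeries c)⁽ⁿ⁾(0)`). [folklore] -/
theorem ExpBound.eq_zero_of_eSeries_eq_zero {c : ℕ → ℂ} (hc : ExpBound c)
    (h : ∀ z, eSeries c z = 0) (n : ℕ) : c n = 0 := by
  have h0 : eSeries c = fun _ => (0 : ℂ) := funext h
  rw [← iteratedDeriv_eSeries_zero hc n, h0, iteratedDeriv_const]
  split_ifs <;> rfl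

/-! ### 2. The recurrence attached to the differential equation (i) -/

section Recurrence

variable {m : ℕ} (P : Fin (m + 1) → Polynomial ℂ)

/-- The coefficient sequence of `∑ⱼ Pⱼ(z) F⁽ʲ⁾(z)` when `deg Pⱼ < D`:
`cₙ = ∑_{j,k<D} pⱼₖ · n(n-1)⋯(n-k+1) · a_{n-k+j}`. [folklore] -/
def odeSeq (a : ℕ → ℂ) (D : ℕ) (n : ℕ) : ℂ :=
  ∑ q ∈ (univ : Finset (Fin (m + 1))) ×ˢ range D,
    (P q.1).coeff q.2 * ((n.descFactorial q.2 : ℂ) * a (n - q.2 + q.1))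

/-- `odeSeq` is geometrically bounded. [folklore] -/
theorem expBound_odeSeq (ha : ExpBound a) (D : ℕ) : ExpBound (odeSeq P a D) := by
  unfold odeSeq
  refine ExpBound.sum _ _ fun q _ => ?_
  exact (expBound_mulXpow (ha.shift_iterate q.1) q.2).const_mul _

/-- **The differential equation coefficientwise**: if `deg Pⱼ < D` then
`∑ⱼ Pⱼ(z) F⁽ʲ⁾(z) = eSeries (odeSeq P a D) z`. [folklore] -/
theorem sum_eval_mul_iteratedDeriv_eq_eSeries (ha : ExpBound a) {D : ℕ}
    (hD : ∀ j, (P j).natDegree < D) (z : ℂ) :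
    ∑ j : Fin (m + 1), (P j).eval z * iteratedDeriv j (eSeries a) z = eSeries (odeSeq P a D) z := by
  unfold odeSeq
  rw [eSeries_finset_sum _ _ (fun q _ => (expBound_mulXpow (ha.shift_iterate q.1) q.2).const_mul _),
    sum_product]
  refine sum_congr rfl fun j _ => ?_
  rw [eval_eq_sum_range' (hD j), sum_mul]
  refine sum_congr rfl fun k _ => ?_
  rw [iteratedDeriv_eSeries ha j, mul_assoc, (ha.shift_iterate j).pow_mul_eSeries k z,
    congr_fun (eSeries_const_mul _ _) z]
  rfl

/-- The shift `σ(j,k) = D - k + j` of the pair `(j,k)` (for `n = n′ + D`, the term `(j,k)` of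
`odeSeq` involves `a_{n′ + σ(j,k)}`). [folklore] -/
def odeShift (D : ℕ) (q : Fin (m + 1) × ℕ) : ℕ := D - q.2 + q.1

/-- The pairs `(j,k)`, `k < D`, with `pⱼₖ ≠ 0`. [folklore] -/
def odeIdx (D : ℕ) : Finset (Fin (m + 1) × ℕ) :=
  ((univ : Finset (Fin (m + 1))) ×ˢ range D).filter fun q => (P q.1).coeff q.2 ≠ 0

/-- The leading polynomial `Λ = ∑_{σ(j,k) = s} pⱼₖ · X(X-1)⋯(X-k+1)` of the recurrence,
`s = max σ`. [folklore] -/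
def odeLead (D s : ℕ) : Polynomial ℂ :=
  ∑ q ∈ (odeIdx P D).filter (fun q => odeShift D q = s), (P q.1).coeff q.2 • descPochhammer ℂ q.2

/-- `odeSeq` at `n′ + D`, regrouped: leading term `Λ(n′+D) · a_{n′+s}` plus the terms of
smaller shift. [folklore] -/
theorem odeSeq_add_eq (a : ℕ → ℂ) {D : ℕ} (n' : ℕ) (s : ℕ) :
    odeSeq P a D (n' + D) =
      (odeLead P D s).eval ((n' + D : ℕ) : ℂ) * a (n' + s) +
      ∑ q ∈ (odeIdx P D).filter (fun q => odeShift D q ≠ s),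
        (P q.1).coeff q.2 * (((n' + D).descFactorial q.2 : ℂ) * a (n' + odeShift D q)) := by
  -- restrict to the pairs with non-zero coefficient and rewrite the indices `n' + D - k + j`
  have hidx : odeSeq P a D (n' + D) = ∑ q ∈ odeIdx P D,
      (P q.1).coeff q.2 * (((n' + D).descFactorial q.2 : ℂ) * a (n' + odeShift D q)) := by
    unfold odeSeq odeIdx
    rw [sum_filter_of_ne fun q _ hne => ?_]
    · refine sum_congr rfl fun q hq => ?_
      have hk : q.2 ≤ D := (mem_range.mp (mem_product.mp hq).2).le
      simp only [odeShift]
      rw [Nat.add_sub_assoc hk, Nat.add_assoc]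
    · intro h0
      exact hne (by rw [h0, zero_mul])
  rw [hidx, ← sum_filter_add_sum_filter_not (odeIdx P D) (fun q => odeShift D q = s)]
  congr 1
  rw [odeLead, eval_finsetSum, sum_mul]
  refine sum_congr rfl fun q hq => ?_
  have hqs : odeShift D q = s := (mem_filter.mp hq).2
  rw [eval_smul, descPochhammer_eval_eq_descFactorial, smul_eq_mul, hqs]
  ring

/-- The leading polynomial is non-zero as soon as some `pⱼₖ ≠ 0` (the descending factorials of
the pairs with maximal shift have pairwise distinct degrees `k`). [folklore] -/
theorem odeLead_ne_zero {D : ℕ} (s : ℕ)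
    (hne : ((odeIdx P D).filter fun q => odeShift D q = s).Nonempty)
    (hD : ∀ q ∈ odeIdx P D, q.2 < D) : odeLead P D s ≠ 0 := by
  set F := (odeIdx P D).filter fun q => odeShift D q = s with hF
  -- the pair of `F` with the largest `k`
  obtain ⟨q₀, hq₀, hmax⟩ := exists_max_image F (fun q => q.2) hne
  have hinj : ∀ q ∈ F, q.2 = q₀.2 → q = q₀ := by
    intro q hq hk
    have h1 : odeShift D q = s := (mem_filter.mp hq).2
    have h2 : odeShift D q₀ = s := (mem_filter.mp hq₀).2
    have hqD : q.2 < D := hD q (mem_filter.mp hq).1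
    have hq₀D : q₀.2 < D := hD q₀ (mem_filter.mp hq₀).1
    simp only [odeShift] at h1 h2
    have hj : (q.1 : ℕ) = q₀.1 := by omega
    exact Prod.ext (Fin.ext hj) hk
  intro h0
  have hcoeff : (odeLead P D s).coeff q₀.2 = (P q₀.1).coeff q₀.2 := by
    rw [odeLead, ← hF, finsetSum_coeff, sum_eq_single q₀]
    · have h1 : (descPochhammer ℂ q₀.2).coeff q₀.2 = 1 := by
        simpa [descPochhammer_natDegree] using (monic_descPochhammer ℂ q₀.2).coeff_natDegree
      rw [coeff_smul, smul_eq_mul, h1, mul_one]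
    · intro q hq hne'
      have hlt : q.2 < q₀.2 := lt_of_le_of_ne (hmax q hq) fun h => hne' (hinj q hq h)
      rw [coeff_smul, smul_eq_mul, coeff_eq_zero_of_natDegree_lt (p := descPochhammer ℂ q.2)
        (by rwa [descPochhammer_natDegree]), mul_zero]
    · exact fun h => (h hq₀).elim
  have hp : (P q₀.1).coeff q₀.2 ≠ 0 := (mem_filter.mp (mem_filter.mp hq₀).1).2
  exact hp (by rw [← hcoeff, h0, coeff_zero])

end Recurrence

/-! ### 3. The coefficients lie in a number field -/

/-- A non-zero complex polynomial does not vanish at the naturals `n ≥ N₀`, for some `N₀`.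
[folklore] -/
theorem exists_forall_le_eval_natCast_ne_zero {Λ : Polynomial ℂ} (hΛ : Λ ≠ 0) :
    ∃ N₀ : ℕ, ∀ n, N₀ ≤ n → Λ.eval (n : ℂ) ≠ 0 := by
  have hfin : {n : ℕ | Λ.eval (n : ℂ) = 0}.Finite :=
    (finite_setOf_isRoot hΛ).preimage (Nat.cast_injective.injOn)
  obtain ⟨N, hN⟩ := hfin.bddAbove
  refine ⟨N + 1, fun n hn h0 => ?_⟩
  have := hN (show n ∈ {n : ℕ | Λ.eval (n : ℂ) = 0} from h0)
  omega

/-- **The coefficients of a strict `E`-function lie in a number field** `ℚ(S)`, `S` a finite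
set of algebraic numbers ("Il en découle que les `aₙ` vivent dans un certain corps de nombres").
PROVED via the recurrence attached to condition (i) of Définition 5.2.
[cite: Rivoal2024, §5.1 p. 228] -/
theorem IsStrictEFunction.exists_finset_adjoin (h : IsStrictEFunction a) :
    ∃ S : Finset ℂ, (∀ x ∈ S, IsAlgebraic ℚ x) ∧
      ∀ n, a n ∈ IntermediateField.adjoin ℚ (S : Set ℂ) := by
  classical
  have ha : ExpBound a := h.expBound
  obtain ⟨m, P, hP0, hPalg, hODE⟩ := h.2.1
  -- degree bound `D`
  set D : ℕ := (univ.sup fun j => (P j).natDegree) + 1 with hDdef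
  have hD : ∀ j, (P j).natDegree < D := fun j =>
    Nat.lt_succ_of_le (le_sup (f := fun j => (P j).natDegree) (mem_univ j))
  have hDidx : ∀ q ∈ odeIdx P D, q.2 < D := fun q hq =>
    mem_range.mp (mem_product.mp (mem_filter.mp hq).1).2
  -- the recurrence `odeSeq P a D n = 0`
  have hrec : ∀ n, odeSeq P a D n = 0 := by
    refine (expBound_odeSeq P ha D).eq_zero_of_eSeries_eq_zero fun z => ?_
    rw [← sum_eval_mul_iteratedDeriv_eq_eSeries P ha hD z]
    exact hODE z
  -- the index set is non-empty since `P ≠ 0`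
  have hne : (odeIdx P D).Nonempty := by
    obtain ⟨j, hj⟩ : ∃ j, P j ≠ 0 := by
      by_contra hcon
      push Not at hcon
      exact hP0 (funext hcon)
    obtain ⟨k, hk⟩ : ∃ k, (P j).coeff k ≠ 0 := by
      by_contra hcon
      push Not at hcon
      exact hj (Polynomial.ext fun k => by simpa using hcon k)
    have hkD : k < D := lt_of_le_of_lt (le_natDegree_of_ne_zero hk) (hD j)
    exact ⟨(j, k), mem_filter.mpr ⟨mem_product.mpr ⟨mem_univ _, mem_range.mpr hkD⟩, hk⟩⟩
  -- maximal shift `s` and the leading polynomial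
  set s : ℕ := (odeIdx P D).sup (odeShift D) with hsdef
  have hs : ∀ q ∈ odeIdx P D, odeShift D q ≤ s := fun q hq => le_sup (f := odeShift D) hq
  have hFne : ((odeIdx P D).filter fun q => odeShift D q = s).Nonempty := by
    obtain ⟨q, hq, hqs⟩ := exists_mem_eq_sup _ hne (odeShift D)
    exact ⟨q, mem_filter.mpr ⟨hq, hqs.symm⟩⟩
  have hΛ : odeLead P D s ≠ 0 := odeLead_ne_zero P s hFne hDidx
  obtain ⟨N₀, hN₀⟩ := exists_forall_le_eval_natCast_ne_zero hΛ
  -- the number field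
  set S : Finset ℂ := ((univ : Finset (Fin (m + 1))) ×ˢ range D).image (fun q => (P q.1).coeff q.2) ∪
    (range (N₀ + s)).image a with hSdef
  set K := IntermediateField.adjoin ℚ (S : Set ℂ) with hKdef
  have hSK : ∀ x ∈ S, x ∈ K := fun x hx => IntermediateField.subset_adjoin ℚ _ (by exact_mod_cast hx)
  have hpK : ∀ q ∈ (univ : Finset (Fin (m + 1))) ×ˢ range D, (P q.1).coeff q.2 ∈ K := fun q hq =>
    hSK _ (mem_union_left _ (mem_image_of_mem _ hq))
  refine ⟨S, fun x hx => ?_, fun n => ?_⟩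
  · -- generators are algebraic
    rcases mem_union.mp hx with hx | hx
    · obtain ⟨q, -, rfl⟩ := mem_image.mp hx
      exact hPalg q.1 q.2
    · obtain ⟨t, -, rfl⟩ := mem_image.mp hx
      exact h.1 t
  · -- all coefficients lie in `K`, by strong induction
    induction n using Nat.strong_induction_on with
    | _ t ih =>
      by_cases ht : t < N₀ + s
      · exact hSK _ (mem_union_right _ (mem_image_of_mem a (mem_range.mpr ht)))
      · -- solve the recurrence at `n' + D`, `n' = t - s`
        push Not at ht
        obtain ⟨n', rfl⟩ : ∃ n', t = n' + s := ⟨t - s, by omega⟩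
        have hn' : N₀ ≤ n' + D := by omega
        have hL : (odeLead P D s).eval ((n' + D : ℕ) : ℂ) ≠ 0 := hN₀ _ hn'
        have hLK : (odeLead P D s).eval ((n' + D : ℕ) : ℂ) ∈ K := by
          rw [odeLead, eval_finsetSum]
          refine K.sum_mem fun q hq => ?_
          rw [eval_smul, descPochhammer_eval_eq_descFactorial, smul_eq_mul]
          exact mul_mem (hpK q (mem_filter.mp (mem_filter.mp hq).1).1) (natCast_mem K _)
        set R := ∑ q ∈ (odeIdx P D).filter (fun q => odeShift D q ≠ s),
          (P q.1).coeff q.2 * (((n' + D).descFactorial q.2 : ℂ) * a (n' + odeShift D q)) with hR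
        have hRK : R ∈ K := by
          refine K.sum_mem fun q hq => ?_
          have hq1 : q ∈ odeIdx P D := (mem_filter.mp hq).1
          have hlt : odeShift D q < s := lt_of_le_of_ne (hs q hq1) (mem_filter.mp hq).2
          refine mul_mem (hpK q (mem_filter.mp hq1).1) (mul_mem (natCast_mem K _) ?_)
          exact ih _ (by omega)
        have heq := odeSeq_add_eq P a (D := D) n' s
        rw [hrec] at heq
        have hsol : a (n' + s) = -R / (odeLead P D s).eval ((n' + D : ℕ) : ℂ) := by
          rw [eq_div_iff hL]
          linear_combination -heq
        rw [hsol]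
        exact div_mem (neg_mem hRK) hLK

end Literature.Barriers.Schanuel

end
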